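import Literature.MathematicalPhysics.QuantumFieldTheory.QCDPhaseQuenchedReweighting
import Literature.MathematicalPhysics.QuantumFieldTheory.LatticeGaugeProofs
import Summits.QuantumFields.QCD.Theorems.SpectralDefectExtinctionWindowExtinctionSpreadTorusBoxes
import Mathlib.MeasureTheory.Integral.Marginal
import HarnessLib

/-!
# Many active cores (stub `stub_activeCoresAbundant`, S5a of reshape r3)

Stub `stub_activeCoresAbundant` of line `free-volume-heavy-witness`
(crux `Summit.QuantumFields.QCD.Theses.SpectralDefectExtinction.WindowExtinction`,
item stmt-QuantumFields-8964).

`N` pairwise `(2R+2)`-separated boxes `cs i + {-R,…,R}⁴` ("cores") sit in the four-torus of side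
`n > 2R+1`; core `i` is ACTIVE in `U` when its content (`U` on the links based in the image of the
box, read as a template `(↥(box 4 R) × Fin 4) → SU(3)`) lies in `T`.  If the phase-quenched density
`ρ = e^{-β S_W} ∏_f |det D_W(m_f)|` changes at most by the factor `Λ` under a refill of one core and
`Haar(T) ≥ q`, then `P(fewer than m cores active) ≤ C(N, N-m+1) (1 - q/Λ²)^{N-m+1}`.

Proof.  (1) Freeze all links but those of core `i` (`lmarginal`): on the fibre `∫ ρ ≤ Λ ρ(u)` for
every content `u`, so the active part carries at least the fraction `Haar(T)/Λ ≥ q/Λ²` of the fibre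
mass (fibre Haar = template Haar through the bijection `(y, μ) ↦ (proj (cs i + y), μ)`,
`2R+1 < n`).  (2) Separated cores have disjoint link sets, so the inactivity of the other cores is
constant along the fibre: `∫_{S inactive} ρ ≤ (1-q/Λ²)^{|S|} ∫ ρ` by induction.  (3) Union bound.
Steps (1)–(2) are proved abstractly (`aca_induct`: cores = coordinate blocks of a finite product
probability space with three fibre hypotheses — law, locality, cost), then specialised.
-/

noncomputable section

namespace Summit.QuantumFields.QCD.Cruxes.WindowExtinction.FreeVolumeHeavyWitness

open MeasureTheory
open Literature.MathematicalPhysics.QuantumLattice Literature.MathematicalPhysics.QuantumFieldTheory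
  Literature.Probability.LatticeModels
open scoped BigOperators ENNReal Classical

/-! ## One block in a frozen environment: the abstract inequality -/

/-- **One refillable block.**  On a probability space, if a finite weight `φ` changes at most by
the factor `Λ ≥ 1` between any two points and `ν T' ≥ q > 0`, then the complement of `T'` carries
at most the fraction `1 - q/Λ²` of the total weight. -/
private theorem aca_lintegral_compl_le {Y : Type*} [MeasurableSpace Y] (ν : Measure Y)
    [IsProbabilityMeasure ν] {φ : Y → ℝ≥0∞} (hφt : ∀ y, φ y ≠ ∞) {Λ q : ℝ} (hΛ : 1 ≤ Λ)
    (hq : 0 < q) (hcost : ∀ y y', φ y' ≤ ENNReal.ofReal Λ * φ y) {T' : Set Y}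
    (hT' : MeasurableSet T') (hqT : ENNReal.ofReal q ≤ ν T') :
    ∫⁻ y in T'ᶜ, φ y ∂ν ≤ ENNReal.ofReal (1 - q / Λ ^ 2) * ∫⁻ y, φ y ∂ν := by
  set I := ∫⁻ y, φ y ∂ν
  set IT := ∫⁻ y in T', φ y ∂ν
  set Ic := ∫⁻ y in T'ᶜ, φ y ∂ν
  have hΛ0 : 0 < Λ := lt_of_lt_of_le one_pos hΛ
  -- the total mass is dominated by `Λ φ y` for every `y`, hence `q I ≤ Λ I_T`
  have hIle : ∀ y, I ≤ ENNReal.ofReal Λ * φ y := fun y =>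
    calc I ≤ ∫⁻ _y', ENNReal.ofReal Λ * φ y ∂ν := lintegral_mono fun y' => hcost y y'
      _ = ENNReal.ofReal Λ * φ y := by rw [lintegral_const, measure_univ, mul_one]
  have hsum : IT + Ic = I := lintegral_add_compl φ hT'
  have hkey : ENNReal.ofReal q * I ≤ ENNReal.ofReal Λ * IT :=
    calc ENNReal.ofReal q * I ≤ ν T' * I := by gcongr
      _ = ∫⁻ _y in T', I ∂ν := by rw [setLIntegral_const, mul_comm]
      _ ≤ ∫⁻ y in T', ENNReal.ofReal Λ * φ y ∂ν := lintegral_mono fun y => hIle y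
      _ = ENNReal.ofReal Λ * IT := by rw [lintegral_const_mul' _ _ ENNReal.ofReal_ne_top]
  -- finiteness, and passage to real numbers
  have hItop : I ≠ ∞ := by
    rcases isEmpty_or_nonempty Y with hY | ⟨⟨y₀⟩⟩
    · have h1 : ν Set.univ = 1 := measure_univ
      rw [Set.univ_eq_empty_iff.2 hY, measure_empty] at h1
      exact absurd h1 zero_ne_one
    · exact ne_top_of_le_ne_top (ENNReal.mul_ne_top ENNReal.ofReal_ne_top (hφt y₀)) (hIle y₀)
  have hITtop : IT ≠ ∞ := ne_top_of_le_ne_top hItop (hsum ▸ le_self_add)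
  have hIctop : Ic ≠ ∞ := ne_top_of_le_ne_top hItop (hsum ▸ le_add_self)
  have hsumR : IT.toReal + Ic.toReal = I.toReal := by rw [← ENNReal.toReal_add hITtop hIctop, hsum]
  have hkeyR : q * I.toReal ≤ Λ * IT.toReal := by
    have := ENNReal.toReal_mono (ENNReal.mul_ne_top ENNReal.ofReal_ne_top hITtop) hkey
    rwa [ENNReal.toReal_mul, ENNReal.toReal_mul, ENNReal.toReal_ofReal hq.le,
      ENNReal.toReal_ofReal hΛ0.le] at this
  have h1 : q * I.toReal / Λ ≤ IT.toReal := by rw [div_le_iff₀ hΛ0]; linarith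
  have h2 : q * I.toReal / Λ ^ 2 ≤ q * I.toReal / Λ :=
    div_le_div_of_nonneg_left (by positivity) hΛ0 (by nlinarith)
  have hgoalR : Ic.toReal ≤ (1 - q / Λ ^ 2) * I.toReal := by
    have : (1 - q / Λ ^ 2) * I.toReal = I.toReal - q * I.toReal / Λ ^ 2 := by ring
    rw [this]; linarith
  calc Ic = ENNReal.ofReal Ic.toReal := (ENNReal.ofReal_toReal hIctop).symm
    _ ≤ ENNReal.ofReal ((1 - q / Λ ^ 2) * I.toReal) := ENNReal.ofReal_le_ofReal hgoalR
    _ = ENNReal.ofReal (1 - q / Λ ^ 2) * I := by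
        rw [ENNReal.ofReal_mul' ENNReal.toReal_nonneg, ENNReal.ofReal_toReal hItop]

/-- **Transport of a product measure along a relabelling of coordinates.**  If `e₀` labels the
coordinates of the block `E` bijectively by `J`, reading a block configuration through `e₀` pushes
the product measure of the block to the product measure on `J → α`. -/
private theorem aca_pi_preimage_eq {J ι α : Type*} [Fintype J] [MeasurableSpace α]
    (μ₀ : Measure α) [SigmaFinite μ₀] {E : Finset ι} {e₀ : J → ι} (he : ∀ j, e₀ j ∈ E)
    (hbij : Function.Bijective fun j => (⟨e₀ j, he j⟩ : ↥E)) (T : Set (J → α)) :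
    (Measure.pi fun _ : ↥E => μ₀) {u | (fun j => u ⟨e₀ j, he j⟩) ∈ T} =
      (Measure.pi fun _ : J => μ₀) T := by
  set σ : J ≃ ↥E := Equiv.ofBijective _ hbij
  have hmp := (measurePreserving_piCongrLeft (fun _ : ↥E => μ₀) σ).symm _
  have happ : ∀ u : ↥E → α,
      (MeasurableEquiv.piCongrLeft (fun _ => α) σ).symm u = fun j => u ⟨e₀ j, he j⟩ :=
    fun u => rfl
  simpa only [Set.preimage, happ] using hmp.measure_preimage_equiv T

/-! ## Sequential conditioning over blocks of a product probability space -/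

section Blocks

variable {ι α X K : Type*} [Fintype ι] [DecidableEq ι] [MeasurableSpace α] (μ₀ : Measure α)
  [IsProbabilityMeasure μ₀] [MeasurableSpace X] {κ : K → (ι → α) → X}
  (hκ : ∀ j, Measurable (κ j)) {T : Set X} (hT : MeasurableSet T) {ρ : (ι → α) → ℝ≥0∞}
  (hρm : Measurable ρ) (hρt : ∀ U, ρ U ≠ ∞) {Λ q : ℝ} (hΛ : 1 ≤ Λ) (hq : 0 < q)
  (E : K → Finset ι)
  (hlaw : ∀ i x, ENNReal.ofReal q ≤
    (Measure.pi fun _ : ↥(E i) => μ₀) {y | κ i (Function.updateFinset x (E i) y) ∈ T})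
  (hloc : ∀ i j, j ≠ i → ∀ x y, κ j (Function.updateFinset x (E i) y) = κ j x)
  (hcost : ∀ i x y y', ρ (Function.updateFinset x (E i) y') ≤
    ENNReal.ofReal Λ * ρ (Function.updateFinset x (E i) y))

omit [Fintype ι] [DecidableEq ι] [MeasurableSpace α] [MeasurableSpace X] in
/-- Membership in the event "every block of `S` is inactive" (`κ j ∉ T` for `j ∈ S`). -/
private theorem aca_mem_inactive {S : Finset K} {U : ι → α} :
    U ∈ (⋂ j ∈ S, κ j ⁻¹' Tᶜ) ↔ ∀ j ∈ S, κ j U ∉ T := by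
  simp only [Set.mem_iInter, Set.mem_preimage, Set.mem_compl_iff]

include hκ hT hρm hρt hΛ hq hlaw hloc hcost

/-- **Peeling one block.**  Integrating out the coordinates of block `i ∉ S₀` (the others frozen,
`lmarginal`), the inactivity of the blocks of `S₀` is constant along the fibre (locality) and the
inactivity of block `i` costs the factor `1 - q/Λ²` (`aca_lintegral_compl_le` on the fibre). -/
private theorem aca_peel {i : K} {S₀ : Finset K} (hi : i ∉ S₀) :
    ∫⁻ U, (⋂ j ∈ insert i S₀, κ j ⁻¹' Tᶜ).indicator ρ U ∂(Measure.pi fun _ : ι => μ₀) ≤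
      ENNReal.ofReal (1 - q / Λ ^ 2) *
        ∫⁻ U, (⋂ j ∈ S₀, κ j ⁻¹' Tᶜ).indicator ρ U ∂(Measure.pi fun _ : ι => μ₀) := by
  set c := ENNReal.ofReal (1 - q / Λ ^ 2) with hc
  have hAm : ∀ S : Finset K, MeasurableSet (⋂ j ∈ S, κ j ⁻¹' Tᶜ) := fun S =>
    Finset.measurableSet_biInter S fun j _ => (hκ j) hT.compl
  rw [← lintegral_const_mul c (hρm.indicator (hAm S₀))]
  refine lintegral_le_of_lmarginal_le (μ := fun _ : ι => μ₀) (E i)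
    (hρm.indicator (hAm _)) ((hρm.indicator (hAm S₀)).const_mul c) (fun x => ?_)
  simp only [lmarginal]
  have hT'm : MeasurableSet {y : ↥(E i) → α | κ i (Function.updateFinset x (E i) y) ∈ T} :=
    ((hκ i).comp measurable_updateFinset) hT
  by_cases hB : ∀ j ∈ S₀, κ j x ∉ T
  · -- the blocks of `S₀` are inactive along the whole fibre
    have hmemS₀ : ∀ y : ↥(E i) → α, Function.updateFinset x (E i) y ∈ ⋂ j ∈ S₀, κ j ⁻¹' Tᶜ := by
      intro y
      rw [aca_mem_inactive]
      intro j hj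
      rw [hloc i j (fun h => hi (h ▸ hj)) x y]
      exact hB j hj
    have hL : ∀ y : ↥(E i) → α,
        (⋂ j ∈ insert i S₀, κ j ⁻¹' Tᶜ).indicator ρ (Function.updateFinset x (E i) y) =
          ({y : ↥(E i) → α | κ i (Function.updateFinset x (E i) y) ∈ T}ᶜ).indicator
            (fun y => ρ (Function.updateFinset x (E i) y)) y := by
      intro y
      by_cases hy : κ i (Function.updateFinset x (E i) y) ∈ T
      · rw [Set.indicator_of_notMem, Set.indicator_of_notMem]
        · simpa only [Set.mem_compl_iff, Set.mem_setOf_eq, not_not] using hy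
        · rw [aca_mem_inactive]
          push Not
          exact ⟨i, Finset.mem_insert_self i S₀, hy⟩
      · rw [Set.indicator_of_mem, Set.indicator_of_mem]
        · simpa only [Set.mem_compl_iff, Set.mem_setOf_eq] using hy
        · rw [aca_mem_inactive]
          intro j hj
          rcases Finset.mem_insert.1 hj with rfl | hj
          · exact hy
          · exact (aca_mem_inactive.1 (hmemS₀ y)) j hj
    have hR : ∀ y : ↥(E i) → α,
        c * (⋂ j ∈ S₀, κ j ⁻¹' Tᶜ).indicator ρ (Function.updateFinset x (E i) y) =
          c * ρ (Function.updateFinset x (E i) y) := fun y => by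
      rw [Set.indicator_of_mem (hmemS₀ y)]
    rw [lintegral_congr hL, lintegral_congr hR, lintegral_indicator hT'm.compl,
      lintegral_const_mul' _ _ ENNReal.ofReal_ne_top]
    exact aca_lintegral_compl_le _ (fun y => hρt _) hΛ hq (hcost i x) hT'm (hlaw i x)
  · -- some block of `S₀` is active: the event is empty along the fibre
    push Not at hB
    obtain ⟨j, hj, hjT⟩ := hB
    have hL0 : ∀ y : ↥(E i) → α,
        (⋂ j ∈ insert i S₀, κ j ⁻¹' Tᶜ).indicator ρ (Function.updateFinset x (E i) y) = 0 := by
      intro y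
      apply Set.indicator_of_notMem
      rw [aca_mem_inactive]
      push Not
      exact ⟨j, Finset.mem_insert_of_mem hj, by rwa [hloc i j (fun h => hi (h ▸ hj)) x y]⟩
    rw [lintegral_congr hL0, lintegral_zero]
    exact zero_le

/-- **Sequential conditioning.**  `∫_{all blocks of S inactive} ρ ≤ (1 - q/Λ²)^{|S|} ∫ ρ`. -/
private theorem aca_induct (S : Finset K) :
    ∫⁻ U, (⋂ j ∈ S, κ j ⁻¹' Tᶜ).indicator ρ U ∂(Measure.pi fun _ : ι => μ₀) ≤
      ENNReal.ofReal (1 - q / Λ ^ 2) ^ S.card * ∫⁻ U, ρ U ∂(Measure.pi fun _ : ι => μ₀) := by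
  induction S using Finset.induction_on with
  | empty =>
    have : (⋂ j ∈ (∅ : Finset K), κ j ⁻¹' Tᶜ) = Set.univ := by ext U; simp
    rw [this, Set.indicator_univ, Finset.card_empty, pow_zero, one_mul]
  | insert i S₀ hi ih =>
    calc _ ≤ ENNReal.ofReal (1 - q / Λ ^ 2) *
          ∫⁻ U, (⋂ j ∈ S₀, κ j ⁻¹' Tᶜ).indicator ρ U ∂(Measure.pi fun _ : ι => μ₀) :=
          aca_peel μ₀ hκ hT hρm hρt hΛ hq E hlaw hloc hcost hi
      _ ≤ ENNReal.ofReal (1 - q / Λ ^ 2) * (ENNReal.ofReal (1 - q / Λ ^ 2) ^ S₀.card *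
          ∫⁻ U, ρ U ∂(Measure.pi fun _ : ι => μ₀)) := mul_le_mul' le_rfl ih
      _ = _ := by rw [Finset.card_insert_of_notMem hi, pow_succ' _ S₀.card, mul_assoc]

end Blocks

/-! ## The stub -/

/-- **Stub `stub_activeCoresAbundant` (many active cores).**  Implant `N` pairwise
`(2R+2)`-separated boxes `cs i + {-R,…,R}⁴` in the four-torus of side `n > 2R+1`, and call core `i`
ACTIVE in `U` when its content (the links based in the image of the box, read as a template on
`↥(box 4 R) × Fin 4`) lies in the measurable class `T` of Haar measure at least `q > 0`.  If the
phase-quenched weight `e^{-β S_W} ∏_f |det D_W(m_f, 1)|` changes at most by the factor `Λ ≥ 1` under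
any refill of one core (the one-box cost bound), then under the phase-quenched lattice-QCD measure
`P(fewer than m active cores) ≤ C(N, N-m+1) (1 - q/Λ²)^{N-m+1}` — sequential conditioning: with the
other links frozen, a core is active with conditional probability at least `q/Λ²`. -/
theorem stub_activeCoresAbundant :
    ∀ (Nf n R N m : ℕ) [NeZero n], 2 * R + 1 < n → ∀ (cs : Fin N → (Fin 4 → ℤ)),
      (∀ i j, i ≠ j → ∀ q : Fin 4 → ℤ, ∃ k : Fin 4, ((2 * R + 2 : ℕ) : ℤ) ≤ |cs i k - cs j k - q k * n|) →
      ∀ (β : ℝ) (μ : Fin Nf → ℝ), (∀ f, 0 < μ f) →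
      ∀ (T : Set ((↥(box 4 R) × Fin 4) → SU3)), MeasurableSet T →
      ∀ (Λ q : ℝ), 1 ≤ Λ → 0 < q →
        q ≤ ((Measure.pi fun _ : ↥(box 4 R) × Fin 4 => haarProbability SU3) T).toReal →
        (∀ (i : Fin N) (U U' : GaugeConfig 4 n SU3),
          (∀ e, (¬ ∃ y : ↥(box 4 R), Torus.proj n (cs i + (y : Fin 4 → ℤ)) = e.1) → U' e = U e) →
          Real.exp (-β * wilsonAction (fundamentalRep (Fin 3)) U') *
              ∏ f, ‖fermionDet (wilsonDirac (fundamentalRep (Fin 3)) U' (μ f) 1)‖ ≤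
            Λ * (Real.exp (-β * wilsonAction (fundamentalRep (Fin 3)) U) *
              ∏ f, ‖fermionDet (wilsonDirac (fundamentalRep (Fin 3)) U (μ f) 1)‖)) →
        qcdLatticeMeasure n β μ
            {U | (Finset.univ.filter fun i : Fin N =>
                (fun yi : ↥(box 4 R) × Fin 4 => U (Torus.proj n (cs i + (yi.1 : Fin 4 → ℤ)), yi.2)) ∈ T).card
              < m} ≤
          ENNReal.ofReal ((N.choose (N - (m - 1)) : ℝ) * (1 - q / Λ ^ 2) ^ (N - (m - 1))) := by
  intro Nf n R N m _ hn cs hsep β μ _hμ T hT Λ q hΛ hq hqT hcost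
  -- the reference product measure and the phase-quenched density
  set π : Measure (GaugeConfig 4 n SU3) := Measure.pi fun _ : Edge 4 n => haarProbability SU3
  set ρ : GaugeConfig 4 n SU3 → ℝ≥0∞ := fun U =>
    ENNReal.ofReal (Real.exp (-β * wilsonAction (fundamentalRep (Fin 3)) U) *
      ∏ f, ‖fermionDet (wilsonDirac (fundamentalRep (Fin 3)) U (μ f) 1)‖) with hρ
  have hgm : Measurable fun U : GaugeConfig 4 n SU3 =>
      ∏ f, ‖fermionDet (wilsonDirac (fundamentalRep (Fin 3)) U (μ f) 1)‖ := by
    simpa only [norm_det_diracMatrix] using measurable_norm_det_diracMatrix (S := n) μ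
  have hfm : Measurable fun U : GaugeConfig 4 n SU3 =>
      Real.exp (-β * wilsonAction (fundamentalRep (Fin 3)) U) :=
    Real.measurable_exp.comp
      ((measurable_wilsonAction _ (continuous_fundamentalRep (Fin 3))).const_mul _)
  have hρm : Measurable ρ := (hfm.mul hgm).ennreal_ofReal
  have hW : qcdLatticeWeight n β μ = π.withDensity ρ := by
    have h1 : ρ =
        (fun U => ENNReal.ofReal (Real.exp (-β * wilsonAction (fundamentalRep (Fin 3)) U))) *
          fun U => ENNReal.ofReal
            (∏ f, ‖fermionDet (wilsonDirac (fundamentalRep (Fin 3)) U (μ f) 1)‖) :=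
      funext fun U => ENNReal.ofReal_mul (Real.exp_pos _).le
    rw [h1, withDensity_mul π hfm.ennreal_ofReal hgm.ennreal_ofReal]
    rfl
  have hcost' : ∀ (i : Fin N) (U U' : GaugeConfig 4 n SU3),
      (∀ e, (¬ ∃ y : ↥(box 4 R), Torus.proj n (cs i + (y : Fin 4 → ℤ)) = e.1) → U' e = U e) →
      ρ U' ≤ ENNReal.ofReal Λ * ρ U := fun i U U' hUU' => by
    simp only [hρ, ← ENNReal.ofReal_mul (show (0 : ℝ) ≤ Λ by linarith)]
    exact ENNReal.ofReal_le_ofReal (hcost i U U' hUU')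
  -- cores as blocks: contents `κ`, link sets `E`, labelling of the links by `↥(box 4 R) × Fin 4`
  set κ : Fin N → GaugeConfig 4 n SU3 → ((↥(box 4 R) × Fin 4) → SU3) :=
    fun j U yi => U (Torus.proj n (cs j + (yi.1 : Fin 4 → ℤ)), yi.2) with hκ
  set E : Fin N → Finset (Edge 4 n) := fun j => Finset.univ.filter fun e =>
    ∃ y : ↥(box 4 R), Torus.proj n (cs j + (y : Fin 4 → ℤ)) = e.1 with hE
  have hmemE : ∀ j e, e ∈ E j ↔ ∃ y : ↥(box 4 R), Torus.proj n (cs j + (y : Fin 4 → ℤ)) = e.1 :=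
    fun j e => by simp only [hE, Finset.mem_filter, Finset.mem_univ, true_and]
  have he : ∀ j (yi : ↥(box 4 R) × Fin 4), (Torus.proj n (cs j + (yi.1 : Fin 4 → ℤ)), yi.2) ∈ E j :=
    fun j yi => (hmemE j _).2 ⟨yi.1, rfl⟩
  have hκm : ∀ j, Measurable (κ j) := fun j => measurable_pi_lambda _ fun _ => measurable_pi_apply _
  have hbij : ∀ j, Function.Bijective fun yi : ↥(box 4 R) × Fin 4 =>
      (⟨(Torus.proj n (cs j + (yi.1 : Fin 4 → ℤ)), yi.2), he j yi⟩ : ↥(E j)) := by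
    refine fun j => ⟨?_, ?_⟩
    · rintro ⟨⟨y, hy⟩, ν⟩ ⟨⟨y', hy'⟩, ν'⟩ h
      simp only [Subtype.mk.injEq, Prod.mk.injEq] at h
      obtain ⟨h1, h2⟩ := h
      have := spread_proj_add_injective hn.le (cs j) hy hy' h1
      subst this; subst h2; rfl
    · rintro ⟨⟨x, ν⟩, hx⟩
      obtain ⟨y, hy⟩ := (hmemE j _).1 hx
      exact ⟨(y, ν), Subtype.ext (Prod.ext hy rfl)⟩
  -- separation in the form consumed by `spread_proj_add_ne` (`D = 1`)
  have hsep' : ∀ i j, i ≠ j → ∀ q : Fin 4 → ℤ, ∃ k : Fin 4,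
      ((2 * R + 1 + 1 : ℕ) : ℤ) ≤ |cs i k - cs j k - q k * n| := fun i j hij q => by
    obtain ⟨k, hk⟩ := hsep i j hij q
    exact ⟨k, by push_cast at hk ⊢; linarith⟩
  -- (law) on the fibre of core `i` the content is Haar distributed on the template space
  have hlaw : ∀ i x, ENNReal.ofReal q ≤ (Measure.pi fun _ : ↥(E i) => haarProbability SU3)
      {y | κ i (Function.updateFinset x (E i) y) ∈ T} := by
    intro i x
    have h1 : ∀ y : ↥(E i) → SU3, κ i (Function.updateFinset x (E i) y) =
        fun yi => y ⟨(Torus.proj n (cs i + (yi.1 : Fin 4 → ℤ)), yi.2), he i yi⟩ := fun y => by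
      funext yi
      simp only [hκ, Function.updateFinset, dif_pos (he i yi)]
    simp only [h1]
    rw [aca_pi_preimage_eq (haarProbability SU3) (he i) (hbij i) T]
    exact ENNReal.ofReal_le_of_le_toReal hqT
  -- (locality) the contents of the other cores do not see a refill of core `i`
  have hloc : ∀ i j, j ≠ i → ∀ (x : GaugeConfig 4 n SU3) (y : ↥(E i) → SU3),
      κ j (Function.updateFinset x (E i) y) = κ j x := by
    intro i j hji x y
    funext yi
    have hnot : (Torus.proj n (cs j + (yi.1 : Fin 4 → ℤ)), yi.2) ∉ E i := fun hmem => by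
      obtain ⟨y', hy'⟩ := (hmemE i _).1 hmem
      exact spread_proj_add_ne (hsep' i j (Ne.symm hji)) y'.2 yi.1.2 hy'
    simp only [hκ, Function.updateFinset, dif_neg hnot]
  -- (cost) two refills of core `i` agree off its links
  have hcostF : ∀ i (x : GaugeConfig 4 n SU3) (y y' : ↥(E i) → SU3),
      ρ (Function.updateFinset x (E i) y') ≤
        ENNReal.ofReal Λ * ρ (Function.updateFinset x (E i) y) := by
    intro i x y y'
    refine hcost' i _ _ fun e he' => ?_
    have hnot : e ∉ E i := fun hmem => he' ((hmemE i e).1 hmem)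
    simp only [Function.updateFinset, dif_neg hnot]
  -- every candidate set of inactive cores is exponentially unlikely
  set c := ENNReal.ofReal (1 - q / Λ ^ 2) with hc
  have hAm : ∀ S : Finset (Fin N), MeasurableSet (⋂ j ∈ S, κ j ⁻¹' Tᶜ) := fun S =>
    Finset.measurableSet_biInter S fun j _ => (hκm j) hT.compl
  have hS : ∀ S : Finset (Fin N),
      π.withDensity ρ (⋂ j ∈ S, κ j ⁻¹' Tᶜ) ≤ c ^ S.card * π.withDensity ρ Set.univ := by
    intro S
    rw [withDensity_apply _ (hAm S), withDensity_apply _ MeasurableSet.univ,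
      Measure.restrict_univ, ← lintegral_indicator (hAm S)]
    exact aca_induct (haarProbability SU3) hκm hT hρm (fun U => ENNReal.ofReal_ne_top) hΛ hq E
      hlaw hloc hcostF S
  have hp1 : 0 ≤ 1 - q / Λ ^ 2 := by
    have h1 : q ≤ 1 := hqT.trans (by
      simpa using ENNReal.toReal_mono ENNReal.one_ne_top (prob_le_one
        (μ := Measure.pi fun _ : ↥(box 4 R) × Fin 4 => haarProbability SU3) (s := T)))
    have h3 : q / Λ ^ 2 ≤ 1 := by rw [div_le_one (by positivity)]; nlinarith
    linarith
  have hP : ∀ A, qcdLatticeMeasure n β μ A = (π.withDensity ρ Set.univ)⁻¹ * π.withDensity ρ A :=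
    fun A => by rw [qcdLatticeMeasure, Measure.smul_apply, smul_eq_mul, hW]
  -- fewer than `m` active cores ⟹ some `N - (m-1)` cores all inactive; union bound; normalise
  set k := N - (m - 1) with hk
  calc qcdLatticeMeasure n β μ _
      ≤ qcdLatticeMeasure n β μ (⋃ S ∈ Finset.powersetCard k (Finset.univ : Finset (Fin N)),
          ⋂ j ∈ S, κ j ⁻¹' Tᶜ) := by
        refine measure_mono fun U hU => ?_
        set act := Finset.univ.filter fun i : Fin N => κ i U ∈ T with hact
        set ina := Finset.univ.filter fun i : Fin N => ¬ κ i U ∈ T with hina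
        have hU' : act.card < m := hU
        have hsum : act.card + ina.card = N := by
          rw [hact, hina, Finset.card_filter_add_card_filter_not, Finset.card_univ,
            Fintype.card_fin]
        obtain ⟨S, hSsub, hScard⟩ := Finset.exists_subset_card_eq (show k ≤ ina.card by omega)
        refine Set.mem_iUnion₂.2 ⟨S, Finset.mem_powersetCard.2 ⟨Finset.subset_univ _, hScard⟩, ?_⟩
        rw [aca_mem_inactive]
        intro j hj
        have := hSsub hj
        rw [hina, Finset.mem_filter] at this
        exact this.2
    _ ≤ ∑ S ∈ Finset.powersetCard k (Finset.univ : Finset (Fin N)),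
          qcdLatticeMeasure n β μ (⋂ j ∈ S, κ j ⁻¹' Tᶜ) := measure_biUnion_finset_le _ _
    _ ≤ ∑ _S ∈ Finset.powersetCard k (Finset.univ : Finset (Fin N)), c ^ k := by
        refine Finset.sum_le_sum fun S hSk => ?_
        rw [hP, ← (Finset.mem_powersetCard.1 hSk).2]
        calc (π.withDensity ρ Set.univ)⁻¹ * π.withDensity ρ (⋂ j ∈ S, κ j ⁻¹' Tᶜ)
            ≤ (π.withDensity ρ Set.univ)⁻¹ * (c ^ S.card * π.withDensity ρ Set.univ) :=
              mul_le_mul' le_rfl (hS S)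
          _ ≤ c ^ S.card := by
              rw [mul_left_comm]
              exact (mul_le_mul' le_rfl (ENNReal.inv_mul_le_one _)).trans_eq (mul_one _)
    _ = (N.choose k : ℝ≥0∞) * c ^ k := by
        rw [Finset.sum_const, Finset.card_powersetCard, Finset.card_univ, Fintype.card_fin,
          nsmul_eq_mul]
    _ = ENNReal.ofReal ((N.choose k : ℝ) * (1 - q / Λ ^ 2) ^ k) := by
        rw [ENNReal.ofReal_mul (by positivity), ENNReal.ofReal_natCast, ENNReal.ofReal_pow hp1]

end Summit.QuantumFields.QCD.Cruxes.WindowExtinction.FreeVolumeHeavyWitness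

end
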